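import Summits.BirchSwinnertonDyer.BirchSwinnertonDyer.Theorems.ClassRecordThreeCornerAtThreeShimuraWalkE0PrimeTDDefs
import Summits.BirchSwinnertonDyer.BirchSwinnertonDyer.Theorems.ClassRecordThreeEulerHalvesAtThreeShimuraInertSavingDisplayOfE0Prime
import Summits.BirchSwinnertonDyer.BirchSwinnertonDyer.Theorems.ClassRecordThreeCornerAtThreeMilneTamagawaHolds
import Summits.BirchSwinnertonDyer.BirchSwinnertonDyer.Theorems.SchneiderFreeAdditiveX3PoitouTateReciprocitySumHolds
import Summits.BirchSwinnertonDyer.BirchSwinnertonDyer.Theorems.ClassRecordThreeEulerHalvesAtThreePoitouTateOfCanonical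
import HarnessLib

/-!
# (DIV) of the carrier-inert Shimura road at `3` from the E′TD primitives — `ShimuraWalk.primitivesDivAtThreeInertD` ⟸
# `ShimuraWalk.PrimitivesWithE0PrimeTDAtThree` + Milne I.3.8 + Poitou–Tate, and UNCONDITIONALLY in the last two (both are tree theorems)
# (cell `bsd-stepL`, seat `bsd-stepL-corner3-p2` g14 = lane B, LINE OWNER of crux 21420; `--supports stmt-BirchSwinnertonDyer-21420 --as helper`)

WHY (r16 of `Cruxes/CornerAtThreeW/Lines/inert.lean`; plan g41 RULING 66 (h) «a later WEAKER item (new decl)»). r15's `stub_upper3_residualMulti` is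
`ShimuraWalk.PrimitivesWithB6TDAtThree` (the printed primitives + the identity-component label (B6) at the carrier primes outside `S`), consumed by
`cornerUpperConsumed3_of_inertStubs` through tam3-p1 g15's (DIV) glue `primitivesDivAtThreeInertD_of_primitivesWithB6TD_of_swapSupplyB6TD_of_levelSupplyB6TD`.
Lane B g14 typed the WEAKER E′TD constant `ShimuraWalk.PrimitivesWithE0PrimeTDAtThree` (`…ShimuraWalkE0PrimeTDDefs`, p641154: Gross's E′-label
«a prime-to-3 multiple of `y_m` lies in `E₀(K[m])_w`» instead of (B6)), and tam3-p1 g18 landed the two port targets at `3 ∈ S` for ONE labelled family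
carrying the E′-labels (`swapSupplyAt_three_of_E0Prime_of_milne_of_poitouTate` ∕ `levelSupplyAt_three_of_E0Prime_of_milne_of_poitouTate`,
`…EulerHalvesAtThreeShimuraInertSavingDisplayOfE0Prime`, over width seat er5-w3 g5's E′-producers). THIS FILE composes them:
* `primitivesDivAtThreeInertD_of_primitivesWithE0PrimeTD_of_milne_of_poitouTate` — (DIV) on the B6D frame ⟸ {E′TD primitives, Milne I.3.8, (∀ K, PT K)}
  (the B6TD glue VERBATIM — bsd-jet's abstract §6 END `JET.Section6.depth_le_mdiv_of_swap_of_perLevel` at `Λ := Conductor W K N 3` — on the two E′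
  port targets);
* `primitivesDivAtThreeInertD_of_primitivesWithE0PrimeTD` — the same with Milne I.3.8 (lane B g10's kernel theorem
  `MilneTamagawa.Milne2006_localTamagawaNumber_smul_unramifiedClass_eq_zero_holds`) and the five-conjunct Poitou–Tate feed (the tree's
  `Koly.poitouTate_conj_forall_of_selmerComplement_canonical` ∘ `SchneiderFreeAdditiveX3.PoitouTateReduction.selmerComplement_canonical_holds`) DISCHARGED:
  **(DIV) ⟸ `PrimitivesWithE0PrimeTDAtThree` ALONE** — so r16 of 21420 (and 19109's line) may read `stub := PrimitivesWithE0PrimeTDAtThree` and keep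
  every downstream byte.
HONEST FRAMING: THEOREMS ONLY (no definition, no named fact, no `sorry`); CONDITIONAL on the E′TD constant (a HYPOTHESIS — the E′-label for the CM family
of `X_{N⁺,N⁻}` is not in print as a sentence; it is the currency an auxiliary-norm argument supplies at a K-split carrier: idea-9 g8 ∕ tam3-p1 g18
`…ShimuraAuxNormE0Prime` with an INERT auxiliary level — void on the corner's 3Ns images, lane B g13 p638602 — or lane B g14's SPLIT auxiliary level);
nothing closes; 21420 ∕ 19109 OPEN; no census label moves (T7); BSD is proved for no curve.
-- adapted from Summits/…/Theorems/ClassRecordThreeEulerHalvesAtThreeShimuraWalkB6TDDefs.lean (the (DIV) glue), port targets ↦ tam3-p1 g18's E′ twins.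
References (locators only): [cite: Jetchev2008, Thm. 1.1, Thm. 1.4 (p. 812)] [cite: McCallumLMS1991, §5 Prop. 5.2, Cor. 5.6]
[cite: GrossLMS1991, §6 proof of Prop. 6.2 (1), p. 245] [cite: MilneADT2006, Ch. I Prop. 3.8, Thm. 4.10 (b)]. presearch: n∕a (glue of tree theorems).
Axioms: `propext`, `Classical.choice`, `Quot.sound`.
-/

set_option autoImplicit false
set_option linter.dupNamespace false

noncomputable section

open scoped Classical

open WeierstrassCurve NumberField IsDedekindDomain Field Function Finset Literature.NumberTheory.EllipticCurves
  Literature.NumberTheory.GaloisRepresentations Literature.NumberTheory.GaloisCohomology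
  Literature.NumberTheory.EllipticCurves.KolyvaginCocycle Literature.NumberTheory.EllipticCurves.RingClassField
  Literature.NumberTheory.EllipticCurves.ModularForms Literature.NumberTheory.EllipticCurves.Rank1Residual
  Literature.NumberTheory.EllipticCurves.KolyvaginEuler Literature.NumberTheory.Automorphic CongruenceSubgroup
  Summit.BirchSwinnertonDyer.Rank1Residual Summit.BirchSwinnertonDyer.Rank1Residual.X11b
  Summit.BirchSwinnertonDyer.Rank1Residual.X11b.Three Summit.BirchSwinnertonDyer.Rank1Residual.JET

namespace Summit.BirchSwinnertonDyer.BirchSwinnertonDyer.Theorems.ShimuraWalk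

open Literature.NumberTheory.EllipticCurves.ShimuraCMFamily

/-- **(DIV) on the B6D frame from the E′TD primitives, Milne I.3.8 and Poitou–Tate**: `primitivesDivAtThreeInertD` ⟸
{`PrimitivesWithE0PrimeTDAtThree`, Milne *ADT* I Prop. 3.8 (Tamagawa form), `∀ K, poitouTate_selmerStructure_duality_conj K`} — the B6TD (DIV) glue
VERBATIM (bsd-jet's abstract §6 END at `Λ := Conductor W K N 3`) on tam3-p1 g18's two E′ port targets. CONDITIONAL; nothing booked.
[cite: Jetchev2008, Thm. 1.1, Thm. 1.4 (p. 812)] [cite: McCallumLMS1991, §5 Prop. 5.2, Cor. 5.6] [cite: GrossLMS1991, §6, p. 245] -/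
theorem primitivesDivAtThreeInertD_of_primitivesWithE0PrimeTD_of_milne_of_poitouTate
    (hprim : PrimitivesWithE0PrimeTDAtThree)
    (hM : Literature.NumberTheory.EllipticCurves.Milne2006_localTamagawaNumber_smul_unramifiedClass_eq_zero.{0})
    (hPT : ∀ (K : Type) [Field K] [NumberField K], poitouTate_selmerStructure_duality_conj K) :
    primitivesDivAtThreeInertD := by
  intro W _ _ N _ K _ _ S Dt X W' _ P₀ hN hirr hK hD hS hin hsp h3S hc hmin
  obtain ⟨ι, y, degy, ys, ε, h0y, hvy, hLy, hguard, hL, hE0⟩ :=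
    hprim W N K S Dt X W' P₀ hN hirr hK hD hS hin hsp h3S hc hmin
  obtain ⟨hε, hB2, hB3, hB3K, hB4, hB5⟩ := id hL
  refine ⟨ι, y, degy, ys, ε, h0y, hvy, hLy, hguard, hε, hB2, hB3, hB3K, hB4, hB5, ?_⟩
  intro q _ s hqS hs k M k' hk' hKol σ' H' instF f' h1 h2 h3 h4
  have hswap : SwapSupplyAt hK ι W N 3 ys :=
    swapSupplyAt_three_of_E0Prime_of_milne_of_poitouTate hM hPT W N K S Dt hN hirr hK hD hin hsp h3S ι y ys ε hL hE0
  have hlev : LevelSupplyAt hK ι W N 3 ys (padicValNat 3 ((W.baseChange ℚ_[q]).localTamagawaNumber ℤ_[q])) :=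
    levelSupplyAt_three_of_E0Prime_of_milne_of_poitouTate hM hPT W N K S Dt hN hirr hK hD hin hsp h3S ι y ys ε hL hE0 q hqS
  set t : ℕ := padicValNat 3 ((W.baseChange ℚ_[q]).localTamagawaNumber ℤ_[q]) with ht
  have hKol' : ∀ q' ∈ k'.primeFactors, IsKolyvaginPrime N W K 3 q' := fun q' hq' ↦ (hKol q' hq').1
  let c : Conductor W K N 3 := ⟨k', hk', hKol'⟩
  have key : ∀ s' : ℕ, s' ≤ t → s' ≤ M + k → PDiv hK ι W ys 3 k' s' := by
    intro s' hs't hs'Mk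
    have hidx : (s' : ℕ∞) ≤ frobLevelIndex W K 3 k' :=
      (natCast_le_frobLevelIndex_iff hKol' s').mpr fun q' hq' ↦ (hKol q' hq').2.of_dvd (pow_dvd_pow 3 hs'Mk)
    have h := JET.Section6.depth_le_mdiv_of_swap_of_perLevel (Λ := Conductor W K N 3)
      (fun c ↦ frobLevelIndex W K 3 c.1) (fun c ↦ mdiv hK ι W ys 3 c.1) t hswap hlev s' hs't c hidx
    exact (natCast_le_mdiv_iff hK ι W ys 3 k' s').mp h
  by_cases hsM : s ≤ M
  · obtain ⟨B₀, hB₀⟩ := key s hs (hsM.trans (Nat.le_add_right M k)) σ' H' f' h1 h2 h3 h4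
    refine ⟨B₀, Eq.trans ?_ (congrArg (fun x ↦ ((3 : ℤ) ^ (M - s)) • x) hB₀)⟩
    show ((3 ^ M : ℕ) : ℤ) • B₀ = ((3 : ℤ) ^ (M - s)) • (((3 ^ s : ℕ) : ℤ) • B₀)
    rw [smul_smul]
    congr 1
    push_cast
    rw [← pow_add, Nat.sub_add_cancel hsM]
  · push Not at hsM
    obtain ⟨B₀, hB₀⟩ := key M (hsM.le.trans hs) (Nat.le_add_right M k) σ' H' f' h1 h2 h3 h4
    refine ⟨B₀, hB₀.trans ?_⟩
    rw [Nat.sub_eq_zero_of_le hsM.le, pow_zero, one_smul]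

/-- **(DIV) ⟸ the E′TD primitives ALONE** — Milne *ADT* I Prop. 3.8 in Tamagawa form is lane B g10's kernel theorem
(`MilneTamagawa.Milne2006_localTamagawaNumber_smul_unramifiedClass_eq_zero_holds`) and the five-conjunct Poitou–Tate feed is the tree's
(`Koly.poitouTate_conj_forall_of_selmerComplement_canonical` at cell bsd-schneider's `selmerComplement_canonical_holds`), so both displayed inputs of
the previous theorem are discharged. CONDITIONAL on the E′TD constant only; nothing booked. [cite: MilneADT2006, Ch. I Prop. 3.8, Thm. 4.10 (b)]
[cite: Jetchev2008, Thm. 1.4] -/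
theorem primitivesDivAtThreeInertD_of_primitivesWithE0PrimeTD (hprim : PrimitivesWithE0PrimeTDAtThree) : primitivesDivAtThreeInertD :=
  primitivesDivAtThreeInertD_of_primitivesWithE0PrimeTD_of_milne_of_poitouTate hprim
    MilneTamagawa.Milne2006_localTamagawaNumber_smul_unramifiedClass_eq_zero_holds
    (Summit.BirchSwinnertonDyer.Rank1Residual.X11b.Three.Koly.poitouTate_conj_forall_of_selmerComplement_canonical fun K _ _ n _ ↦
      SchneiderFreeAdditiveX3.PoitouTateReduction.selmerComplement_canonical_holds K n)

end Summit.BirchSwinnertonDyer.BirchSwinnertonDyer.Theorems.ShimuraWalk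

end
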